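import Literature.MathematicalPhysics.QuantumLattice.HubbardGaugeBound
import Literature.MathematicalPhysics.QuantumLattice.HubbardLiebConfig
import HarnessLib

/-!
# The atomic limit of the Hubbard model: on-site part in the occupation basis and `Z = z₀^{|Λ|}` at `t = 0`

Support file for the strong-coupling / high-temperature expansion of the Hubbard model
(D. Ueltschi, *Analyticity in Hubbard models*, J. Stat. Phys. 95 (1999) 693, §3; the "classical
free energy" `f₀` of §2.1 and its Hubbard value at the beginning of the proof of Theorem 3.1),
written for the tree's concrete Jordan–Wigner model (`HubbardWave0`: `Fock`, `Orb Λ = Λ ×ₗ Fin 2`,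
`creation`/`annihilation`, `numberOp`, `totalNumber`, `hamiltonian`; `HubbardModel.hamiltonianWith`;
`FinDimSpectrum`: `Matrix.partitionFn`). Everything here is PROVED.

## Main results

* `onSiteEnergy U μ s = U · D(s) - μ · |s|`, the eigenvalue of the on-site part
  `U Σ_x n_{x↑} n_{x↓} - μ N` on the occupation-basis vector `|s⟩` (`D(s) = |upPart s ∩ downPart s|`
  doubly occupied sites); complex `U`, `μ` are allowed (the expansion files complexify the
  parameters).
* `densityTerms_eq_diagonal`: the tree's on-site part `densityTerms U μ = U Σ_x n_{x↑} n_{x↓} - μ N`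
  (`HubbardGaugeBound`) IS `diagonal (onSiteEnergy U μ)`; with the tree's
  `hamiltonianWith_eq_hoppingForm` this gives `hamiltonianWith_eq_hoppingForm_add_diagonal`:
  `H(t,U) - μN = -t • hoppingForm G 1 + diagonal (onSiteEnergy U μ)` — the decomposition `H = T + V`
  with `V` on-site AND diagonal in the occupation basis (Ueltschi §2.1, §3); the hopping operator
  `T_G = Σ_{x ∼ y, σ} c†_{xσ} c_{yσ}` is the tree's `hoppingForm G (fun _ _ => 1)`
  (`hoppingForm_one`, `isHermitian_hoppingForm`, `norm_hoppingForm_le`).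
* `Matrix.partitionFn_diagonal`: `Z_β(diagonal d) = Σ_i e^{-β d_i}`.
* `atomicPartitionFn β U μ = 1 + 2 e^{βμ} + e^{-β(U - 2μ)}`, the one-site grand-canonical partition
  function (`e^{-β f₀} `of Ueltschi, §3: `f₀(β, μ) = -β⁻¹ log[1 + 2e^{βμ} + e^{-βU + 2βμ}]`), and the
  **atomic limit** `partitionFn_hamiltonianWith_zero_hopping`:
  `Z_β(H(0, U) - μ N) = (atomicPartitionFn β U μ)^{|Λ|}` on ANY finite graph (the trace factorises
  over sites: `sum_sum_prod_eq_pow`, from Mathlib's `Fintype.prod_add`).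
* Real-parameter API: `atomicPartitionFn_ofReal`, `atomicPartitionFnReal_pos`.

## Mathlib / tree search

Mathlib: `Matrix.exp_diagonal`, `Pi.coe_exp`, `Complex.exp_eq_exp_ℂ`, `Matrix.trace_diagonal`,
`Fintype.prod_add`, `Finset.prod_ite`. Tree: the hopping term is `hoppingForm G (fun _ _ => 1)` and the
on-site part is `densityTerms U μ`, with `hamiltonianWith_eq_hoppingForm : H - μN = -t T(1) + densityTerms`
(`HubbardGaugeBound`), so neither is redefined here — we only identify `densityTerms` with a
diagonal matrix; `numberOp_eq_diagonal`,
`totalNumberOp_eq_diagonal`, `totalNumberOp_eq_totalNumber` (`FermionOperators`),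
`numberOp_mul_numberOp_mulVec` (`HubbardLiebBasis`, the `mulVec` form of
`numberOp_mul_numberOp_eq_diagonal` below), `configEquiv`/`upPart`/`downPart` (`HubbardLiebConfig`).
No atomic-limit partition function existed (`lean search 'atomicPartitionFn|onSiteEnergy|doublyOccupied'`).

## References

* D. Ueltschi, J. Stat. Phys. 95 (1999) 693–717, arXiv:cond-mat/9810320, §2.1 (classical free energy `f₀`), §3
  (proof of Thm. 3.1, formula for `f₀`). [Ueltschi1999]
* H. Tasaki, *Physics and Mathematics of Quantum Many-Body Systems* (2020), §9.3. [Tasaki2020]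
-/

noncomputable section

namespace Literature.MathematicalPhysics.QuantumLattice

open Matrix Finset HubbardWave0
open scoped Matrix.Norms.L2Operator

/-! ### The on-site energy -/

section OnSite

variable {Λ : Type*} [LinearOrder Λ] [Fintype Λ]

/-- The set of doubly occupied sites of the configuration `s` (both `x↑` and `x↓` occupied).
[cite: Ueltschi1999, §3 (local state `2 ∈ Ω = {0, ↑, ↓, 2}`)] -/
def doublyOccupied (s : Finset (Orb Λ)) : Finset Λ := upPart s ∩ downPart s

/-- Membership in `doublyOccupied`. [folklore] -/
@[simp] theorem mem_doublyOccupied (s : Finset (Orb Λ)) (x : Λ) :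
    x ∈ doublyOccupied s ↔ orb x 0 ∈ s ∧ orb x 1 ∈ s := by
  simp [doublyOccupied]

/-- The on-site energy of the configuration `s`: `v(s) = U · #(doubly occupied sites) - μ · #s`,
the eigenvalue of `U Σ_x n_{x↑} n_{x↓} - μ N` on `|s⟩` (complex parameters allowed).
[cite: Ueltschi1999, §3 (Hubbard Hamiltonian, on-site terms)] -/
def onSiteEnergy (U μ : ℂ) (s : Finset (Orb Λ)) : ℂ :=
  U * ((doublyOccupied s).card : ℂ) - μ * (s.card : ℂ)

/-- `n_{x↑} n_{x↓}` is diagonal: it is the indicator of double occupancy of `x` (matrix form of the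
tree's `numberOp_mul_numberOp_mulVec`, `HubbardLiebBasis`). [folklore] -/
theorem numberOp_mul_numberOp_eq_diagonal (x : Λ) :
    numberOp x 0 * numberOp x 1 =
      diagonal fun s : Finset (Orb Λ) => if orb x 0 ∈ s ∧ orb x 1 ∈ s then (1 : ℂ) else 0 := by
  rw [numberOp, numberOp, ← numberAt, ← numberAt, numberAt_eq_diagonal, numberAt_eq_diagonal,
    diagonal_mul_diagonal]
  congr 1
  funext s
  by_cases h0 : orb x 0 ∈ s <;> by_cases h1 : orb x 1 ∈ s <;> simp [h0, h1]

/-- The interaction `Σ_x n_{x↑} n_{x↓}` is diagonal with eigenvalue the number of doubly occupied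
sites. [cite: Tasaki2020, §9.3] -/
theorem sum_numberOp_mul_numberOp_eq_diagonal :
    (∑ x : Λ, numberOp x 0 * numberOp x 1 : Matrix (Finset (Orb Λ)) (Finset (Orb Λ)) ℂ) =
      diagonal fun s => ((doublyOccupied s).card : ℂ) := by
  ext s t
  simp only [Matrix.sum_apply, numberOp_mul_numberOp_eq_diagonal, diagonal_apply]
  by_cases hst : s = t
  · subst hst
    simp only [if_true]
    rw [Finset.sum_boole]
    congr 2
    ext x
    simp
  · simp [hst]

/-- The total number operator is diagonal with eigenvalue `#s`. [cite: Tasaki2020, §9.2] -/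
theorem totalNumber_eq_diagonal_card :
    (totalNumber : Matrix (Finset (Orb Λ)) (Finset (Orb Λ)) ℂ) = diagonal fun s => (s.card : ℂ) := by
  rw [← totalNumberOp_eq_totalNumber, totalNumberOp_eq_diagonal]

/-- The on-site part of the grand-canonical Hubbard Hamiltonian is diagonal in the occupation
basis: `U Σ_x n_{x↑} n_{x↓} - μ N = diagonal (onSiteEnergy U μ)`. [cite: Ueltschi1999, §2.1 (local interaction V) and §3] -/
theorem onSite_eq_diagonal (U μ : ℂ) :
    (U • ∑ x : Λ, numberOp x 0 * numberOp x 1 - μ • totalNumber :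
        Matrix (Finset (Orb Λ)) (Finset (Orb Λ)) ℂ) = diagonal (onSiteEnergy U μ) := by
  rw [sum_numberOp_mul_numberOp_eq_diagonal, totalNumber_eq_diagonal_card]
  ext s t
  by_cases hst : s = t
  · subst hst
    simp [onSiteEnergy]
  · simp [hst]

/-- **Bridge to the tree's on-site operator**: `densityTerms U μ = U Σ_x n_{x↑} n_{x↓} - μ N`
(`HubbardGaugeBound`) is the diagonal matrix of on-site energies. [cite: Ueltschi1999, §2.1 (local interaction V) and §3] -/
theorem densityTerms_eq_diagonal (U μ : ℝ) :
    (densityTerms U μ : Matrix (Finset (Orb Λ)) (Finset (Orb Λ)) ℂ) =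
      diagonal (onSiteEnergy (U : ℂ) (μ : ℂ)) := by
  rw [densityTerms]
  exact onSite_eq_diagonal _ _

/-- **`H = T + V` with `V` diagonal.** The grand-canonical Hubbard Hamiltonian splits as
`H(t,U) - μN = -t • T_G + diagonal (onSiteEnergy U μ)` with `T_G = hoppingForm G 1 = Σ_{x∼y,σ} c†_{xσ}c_{yσ}`
(the tree's `hamiltonianWith_eq_hoppingForm` plus `densityTerms_eq_diagonal`; Ueltschi (1999) §3
writes the kinetic term as `-t Σ_𝐀 T_𝐀`, `T_𝐀 = c†_{xσ} c_{yσ}`). [cite: Ueltschi1999, §2.1 and §3 (H = V + T)] -/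
theorem hamiltonianWith_eq_hoppingForm_add_diagonal (G : SimpleGraph Λ) [DecidableRel G.Adj]
    (t U μ : ℝ) :
    hamiltonianWith G t U μ =
      -(t : ℂ) • hoppingForm G (fun _ _ => 1) + diagonal (onSiteEnergy (U : ℂ) (μ : ℂ)) := by
  rw [hamiltonianWith_eq_hoppingForm, densityTerms_eq_diagonal]

/-- In the atomic limit `t = 0` the grand-canonical Hubbard Hamiltonian is the diagonal on-site
operator. [cite: Ueltschi1999, §3 (classical free energy of the Hubbard model)] -/
theorem hamiltonianWith_zero_hopping (G : SimpleGraph Λ) [DecidableRel G.Adj] (U μ : ℝ) :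
    hamiltonianWith G 0 U μ = diagonal (onSiteEnergy (U : ℂ) (μ : ℂ)) := by
  rw [hamiltonianWith_eq_hoppingForm_add_diagonal]
  simp

end OnSite

/-! ### Partition function of a diagonal Hamiltonian -/

/-- (Dot-notation extension of Mathlib's `Matrix`, next to `Matrix.partitionFn`.) The partition
function of a diagonal Hamiltonian is the sum of the Boltzmann factors of its diagonal entries,
`Z_β(diagonal d) = Σ_i e^{-β d_i}` (complex entries allowed). [folklore] -/
theorem _root_.Matrix.partitionFn_diagonal {n : Type*} [Fintype n] [DecidableEq n] (β : ℝ)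
    (d : n → ℂ) : Matrix.partitionFn β (diagonal d) = ∑ i, Complex.exp (-(β * d i)) := by
  unfold Matrix.partitionFn Matrix.gibbsWeight
  rw [show (-(β : ℂ) • diagonal d) = diagonal (fun i => -(β * d i)) by
    ext i j
    simp only [diagonal_apply, Matrix.smul_apply, smul_eq_mul]
    split_ifs <;> simp]
  rw [Matrix.exp_diagonal, trace_diagonal]
  simp [Pi.coe_exp, Complex.exp_eq_exp_ℂ]

/-! ### Factorisation of configuration sums over sites -/

section Factorisation

variable {Λ : Type*} [Fintype Λ] [DecidableEq Λ] {R : Type*} [CommSemiring R]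

/-- A product over all sites of a quantity depending on membership in `β` splits into the
product over `β` and the product over its complement (`Finset.prod_ite`). [folklore] -/
private theorem prod_ite_mem_eq_prod_mul_prod_compl (β : Finset Λ) (f g : Λ → R) :
    (∏ x, if x ∈ β then f x else g x) = (∏ x ∈ β, f x) * ∏ x ∈ βᶜ, g x := by
  rw [Finset.prod_ite]
  congr 1
  · rw [Finset.filter_mem_eq_inter, Finset.univ_inter]
  · congr 1
    ext x
    simp [Finset.mem_compl]

/-- **One binary degree of freedom per site**: `Σ_{β ⊆ Λ} Π_x φ_x(x ∈ β) = Π_x (φ_x(true) + φ_x(false))`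
(Mathlib's `Fintype.prod_add` read backwards). [folklore] -/
private theorem sum_prod_ite_mem_eq_prod_add (f g : Λ → R) :
    (∑ β : Finset Λ, ∏ x, if x ∈ β then f x else g x) = ∏ x, (f x + g x) := by
  rw [Fintype.prod_add]
  exact Finset.sum_congr rfl fun β _ => prod_ite_mem_eq_prod_mul_prod_compl β f g

/-- **Two binary degrees of freedom per site** (spin up / spin down occupied or not):
`Σ_{α, β ⊆ Λ} Π_x φ(x ∈ α, x ∈ β) = (φ(1,1) + φ(1,0) + φ(0,1) + φ(0,0))^{|Λ|}` for a site-independent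
table `φ`. This is the factorisation of the atomic-limit trace over sites. [cite: Ueltschi1999, §2.1 (f₀ is a one-site quantity)] -/
theorem sum_sum_prod_eq_pow (φ : Bool → Bool → R) :
    (∑ α : Finset Λ, ∑ β : Finset Λ, ∏ x, φ (decide (x ∈ α)) (decide (x ∈ β))) =
      (φ true true + φ true false + φ false true + φ false false) ^ Fintype.card Λ := by
  have inner : ∀ α : Finset Λ, (∑ β : Finset Λ, ∏ x, φ (decide (x ∈ α)) (decide (x ∈ β))) =
      ∏ x, (φ (decide (x ∈ α)) true + φ (decide (x ∈ α)) false) := by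
    intro α
    rw [← sum_prod_ite_mem_eq_prod_add]
    refine Finset.sum_congr rfl fun β _ => Finset.prod_congr rfl fun x _ => ?_
    by_cases hx : x ∈ β <;> simp [hx]
  simp_rw [inner]
  have outer : (∑ α : Finset Λ, ∏ x, (φ (decide (x ∈ α)) true + φ (decide (x ∈ α)) false)) =
      ∏ _x : Λ, ((φ true true + φ true false) + (φ false true + φ false false)) := by
    rw [← sum_prod_ite_mem_eq_prod_add]
    refine Finset.sum_congr rfl fun α _ => Finset.prod_congr rfl fun x _ => ?_
    by_cases hx : x ∈ α <;> simp [hx]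
  rw [outer, Finset.prod_const, Finset.card_univ]
  ring

end Factorisation

/-! ### The atomic limit `t = 0` -/

section AtomicLimit

variable {Λ : Type*} [LinearOrder Λ] [Fintype Λ]

/-- The one-site grand-canonical partition function of the Hubbard atom,
`z₀(β, U, μ) = 1 + 2 e^{βμ} + e^{-β(U - 2μ)}` (empty, singly occupied with either spin, doubly
occupied); Ueltschi's classical free energy is `f₀ = -β⁻¹ log z₀` (§3). Complex parameters are
allowed. [cite: Ueltschi1999, §3 (formula for f₀(β, μ))] -/
def atomicPartitionFn (β U μ : ℂ) : ℂ :=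
  1 + 2 * Complex.exp (β * μ) + Complex.exp (-(β * (U - 2 * μ)))

/-- The Boltzmann factor of a configuration factorises over sites into the one-site table
`φ(up, down)`: `e^{-β v(s)} = Π_x φ(x↑ ∈ s, x↓ ∈ s)` with `φ(1,1) = e^{-β(U-2μ)}`,
`φ(1,0) = φ(0,1) = e^{βμ}`, `φ(0,0) = 1`. [cite: Ueltschi1999, §2.3 (bound on matrix elements, per-site factorisation of e^{-τV})] -/
def atomicBoltzmannTable (β U μ : ℂ) : Bool → Bool → ℂ
  | true, true => Complex.exp (-(β * (U - 2 * μ)))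
  | true, false => Complex.exp (β * μ)
  | false, true => Complex.exp (β * μ)
  | false, false => 1

/-- The on-site energy written with the up/down sets: `v(s) = Σ_x [U·1(x↑,x↓ ∈ s) - μ(1(x↑∈s) + 1(x↓∈s))]`.
[folklore] -/
theorem onSiteEnergy_eq_sum (U μ : ℂ) (s : Finset (Orb Λ)) :
    onSiteEnergy U μ s = ∑ x : Λ,
      (U * (if x ∈ upPart s ∧ x ∈ downPart s then 1 else 0) -
        μ * ((if x ∈ upPart s then 1 else 0) + (if x ∈ downPart s then 1 else 0))) := by
  have hup : (univ.filter fun x : Λ => x ∈ upPart s) = upPart s := by ext x; simp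
  have hdown : (univ.filter fun x : Λ => x ∈ downPart s) = downPart s := by ext x; simp
  have hdbl : (univ.filter fun x : Λ => x ∈ upPart s ∧ x ∈ downPart s) = doublyOccupied s := by
    ext x; simp
  rw [onSiteEnergy, card_eq_upPart_add_downPart, Finset.sum_sub_distrib, ← Finset.mul_sum,
    ← Finset.mul_sum, Finset.sum_add_distrib, Finset.sum_boole, Finset.sum_boole, Finset.sum_boole,
    hup, hdown, hdbl]
  push_cast
  ring

/-- The Boltzmann factor of `|s⟩` in the atomic limit is the product over sites of the one-site
table. [folklore] -/
theorem exp_neg_mul_onSiteEnergy (β U μ : ℂ) (s : Finset (Orb Λ)) :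
    Complex.exp (-(β * onSiteEnergy U μ s)) =
      ∏ x : Λ, atomicBoltzmannTable β U μ (decide (x ∈ upPart s)) (decide (x ∈ downPart s)) := by
  rw [onSiteEnergy_eq_sum, Finset.mul_sum, ← Finset.sum_neg_distrib, Complex.exp_sum]
  refine Finset.prod_congr rfl fun x _ => ?_
  by_cases hu : x ∈ upPart s
  · by_cases hd : x ∈ downPart s
    · simp only [hu, hd, and_self, if_true, atomicBoltzmannTable, decide_true]
      ring_nf
    · simp [hu, hd, atomicBoltzmannTable]
  · by_cases hd : x ∈ downPart s
    · simp [hu, hd, atomicBoltzmannTable]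
    · simp [hu, hd, atomicBoltzmannTable]

/-- **The atomic limit.** At `t = 0` the grand-canonical partition function of the Hubbard model on
any finite graph factorises over sites: `Z_β(H(0,U) - μN) = z₀(β,U,μ)^{|Λ|}` with
`z₀ = 1 + 2e^{βμ} + e^{-β(U-2μ)}`; equivalently `f₀ = -β⁻¹ log z₀` is the free energy density at
`t = 0` in every finite volume. [cite: Ueltschi1999, §3 (f₀(β, μ) = -β⁻¹ log[1 + 2e^{βμ} + e^{-βU+2βμ}])] -/
theorem partitionFn_hamiltonianWith_zero_hopping (G : SimpleGraph Λ) [DecidableRel G.Adj] (β U μ : ℝ) :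
    Matrix.partitionFn β (hamiltonianWith G 0 U μ) =
      atomicPartitionFn β U μ ^ Fintype.card Λ := by
  classical
  rw [hamiltonianWith_zero_hopping, Matrix.partitionFn_diagonal]
  have h1 : (∑ s : Finset (Orb Λ), Complex.exp (-(β * onSiteEnergy (U : ℂ) (μ : ℂ) s))) =
      ∑ p : Finset Λ × Finset Λ, Complex.exp (-(β * onSiteEnergy (U : ℂ) (μ : ℂ) (configEquiv.symm p))) :=
    (configEquiv.symm.sum_comp _).symm
  rw [h1, Fintype.sum_prod_type]
  simp only [configEquiv, Equiv.coe_fn_symm_mk, exp_neg_mul_onSiteEnergy, upPart_pairSet,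
    downPart_pairSet]
  rw [sum_sum_prod_eq_pow]
  simp only [atomicBoltzmannTable, atomicPartitionFn]
  ring

/-- The real one-site partition function `z₀(β, U, μ) = 1 + 2e^{βμ} + e^{-β(U-2μ)}` for real
parameters. [cite: Ueltschi1999, §3 (formula for f₀(β, μ))] -/
def atomicPartitionFnReal (β U μ : ℝ) : ℝ :=
  1 + 2 * Real.exp (β * μ) + Real.exp (-(β * (U - 2 * μ)))

/-- For real parameters the complex one-site partition function is the real one. [folklore] -/
theorem atomicPartitionFn_ofReal (β U μ : ℝ) :
    atomicPartitionFn β U μ = (atomicPartitionFnReal β U μ : ℂ) := by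
  simp only [atomicPartitionFn, atomicPartitionFnReal, Complex.ofReal_add, Complex.ofReal_mul,
    Complex.ofReal_exp, Complex.ofReal_neg, Complex.ofReal_sub, Complex.ofReal_one, Complex.ofReal_ofNat]

/-- `z₀ > 0` (indeed `z₀ > 1`). [folklore] -/
theorem atomicPartitionFnReal_pos (β U μ : ℝ) : 0 < atomicPartitionFnReal β U μ := by
  unfold atomicPartitionFnReal
  positivity

/-- The atomic-limit partition function for real parameters, as a real power:
`Z_β(H(0,U) - μN) = (z₀ : ℝ)^{|Λ|}` (coerced to `ℂ`). [cite: Ueltschi1999, §3 (formula for f₀(β, μ))] -/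
theorem partitionFn_hamiltonianWith_zero_hopping_ofReal (G : SimpleGraph Λ) [DecidableRel G.Adj] (β U μ : ℝ) :
    Matrix.partitionFn β (hamiltonianWith G 0 U μ) =
      ((atomicPartitionFnReal β U μ ^ Fintype.card Λ : ℝ) : ℂ) := by
  rw [partitionFn_hamiltonianWith_zero_hopping, atomicPartitionFn_ofReal, Complex.ofReal_pow]

/-- `z₀` is real-analytic in `(β, μ)` jointly, for every fixed `U`. [folklore] -/
theorem analyticAt_atomicPartitionFnReal (U : ℝ) (p : ℝ × ℝ) :
    AnalyticAt ℝ (fun q : ℝ × ℝ => atomicPartitionFnReal q.1 U q.2) p := by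
  unfold atomicPartitionFnReal
  have h1 : AnalyticAt ℝ (fun q : ℝ × ℝ => q.1) p := analyticAt_fst
  have h2 : AnalyticAt ℝ (fun q : ℝ × ℝ => q.2) p := analyticAt_snd
  have h12 : AnalyticAt ℝ (fun q : ℝ × ℝ => q.1 * q.2) p := h1.mul h2
  have hexp1 : AnalyticAt ℝ (fun q : ℝ × ℝ => Real.exp (q.1 * q.2)) p :=
    analyticAt_rexp.comp h12
  have h3 : AnalyticAt ℝ (fun q : ℝ × ℝ => -(q.1 * (U - 2 * q.2))) p :=
    (h1.mul (analyticAt_const.sub (analyticAt_const.mul h2))).neg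
  have hexp2 : AnalyticAt ℝ (fun q : ℝ × ℝ => Real.exp (-(q.1 * (U - 2 * q.2)))) p :=
    analyticAt_rexp.comp h3
  exact (analyticAt_const.add (analyticAt_const.mul hexp1)).add hexp2

end AtomicLimit

end Literature.MathematicalPhysics.QuantumLattice
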